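import Literature.Probability.LatticeModels.IsingBoundaryMonotonicity
import Literature.Probability.LatticeModels.IsingMonotonicity
import Literature.Probability.LatticeModels.GriffithsMonotonicity
import Mathlib.Logic.Function.DependsOn
import HarnessLib

/-!
# Local observables under two ordered boundary conditions: the difference of expectations is
# controlled by the one-point functions (FKG), proved

Topic `Probability/LatticeModels`. For the finite-volume Ising model `μ^{η}_{Λ;β,h}` of `IsingModel`
on an arbitrary locally finite graph, `β ≥ 0`, boundary conditions `η₁ ≤ η₂`, and an observable
`g` depending only on the spins in a finite set `D` with `|g| ≤ M`:

  `|⟨g⟩^{η₂}_{Λ;β,h} - ⟨g⟩^{η₁}_{Λ;β,h}| ≤ M ∑_{x ∈ D} (⟨σ_x⟩^{η₂}_{Λ;β,h} - ⟨σ_x⟩^{η₁}_{Λ;β,h})`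

(`abs_isingExpect_fixed_sub_le_sum`). Proof: `± g + 2M ∑_{x ∈ D} (1 + σ_x)/2` are nondecreasing
(raising spins of `D` raises the sum by at least the number of raised sites, while `g` moves by
at most `2M`; raising spins off `D` does not move `g`), so the FKG monotonicity in the boundary
condition (`isingExpect_fixed_mono`, Friedli–Velenik 2017, Exercise 3.13, proved in
`IsingBoundaryMonotonicity`) bounds `±(⟨g⟩^{η₂} - ⟨g⟩^{η₁})`. This is the finite-volume form of the
classical fact that two FKG-ordered states with equal one-point functions coincide
(Lebowitz–Martin-Löf 1972; Friedli–Velenik 2017, Lemma 3.31 / proof of Theorem 3.28: equality of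
magnetisations implies `μ⁺ = μ⁻`), in a quantitative version convenient for uniqueness arguments
(van Enter–Fernández–Sokal 1993, §4.3.1 Step 2.2).

## References

* J. L. Lebowitz, A. Martin-Löf, Comm. Math. Phys. 25 (1972) 276–282.
* S. Friedli, Y. Velenik, *Statistical Mechanics of Lattice Systems* (CUP 2017), §3.6.2,
  Exercise 3.13, §3.7.2 (Theorem 3.28, Lemma 3.31).
-/

noncomputable section

open MeasureTheory Finset

namespace Literature.Probability.LatticeModels

variable {V : Type*} (G : SimpleGraph V) [DecidableEq V] [G.LocallyFinite]

omit [DecidableEq V] in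
/-- **Monotonisation of a bounded local observable**: if `g` depends only on the spins in `D` and
`|g| ≤ M`, then `σ ↦ s g(σ) + 2M ∑_{x ∈ D} (1 + σ_x)/2` is nondecreasing for `s = ±1`.
[cite: FriedliVelenik2017, §3.6.2 (nondecreasing functions)] -/
theorem monotone_smul_add_sum_of_dependsOn {g : SpinConfig V → ℝ} {D : Finset V}
    (hgD : DependsOn g (↑D : Set V)) {M : ℝ} (hM : ∀ σ, |g σ| ≤ M) {s : ℝ} (hs : s = 1 ∨ s = -1) :
    Monotone fun σ => s * g σ + 2 * M * ∑ x ∈ D, (1 + spinAt x σ) / 2 := by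
  intro σ τ hle
  by_cases hD : ∀ x ∈ D, σ x = τ x
  · have hg : g σ = g τ := hgD fun x hx => hD x (Finset.mem_coe.1 hx)
    have hN : ∑ x ∈ D, (1 + spinAt x σ) / 2 = ∑ x ∈ D, (1 + spinAt x τ) / 2 :=
      Finset.sum_congr rfl fun x hx => by simp only [spinAt, hD x hx]
    simp only [hg, hN, le_refl]
  · push Not at hD
    obtain ⟨x₀, hx₀, hne⟩ := hD
    have hM0 : 0 ≤ M := (abs_nonneg _).trans (hM σ)
    -- the sum rises by at least one
    have hterm : ∀ x ∈ D, 0 ≤ (1 + spinAt x τ) / 2 - (1 + spinAt x σ) / 2 := fun x _ => by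
      have := spinAt_mono x hle
      linarith
    have hx₀term : 1 ≤ (1 + spinAt x₀ τ) / 2 - (1 + spinAt x₀ σ) / 2 := by
      have hσ : σ x₀ = -1 := by
        rcases Int.units_eq_one_or (σ x₀) with h | h
        · exfalso
          have h1 : τ x₀ = 1 := intUnits_eq_one_of_one_le (h ▸ hle x₀)
          exact hne (h.trans h1.symm)
        · exact h
      have hτ : τ x₀ = 1 := by
        rcases Int.units_eq_one_or (τ x₀) with h | h
        · exact h
        · exact absurd (hσ.trans h.symm) hne
      simp [spinAt, hσ, hτ]
    have hsum : 1 ≤ ∑ x ∈ D, (1 + spinAt x τ) / 2 - ∑ x ∈ D, (1 + spinAt x σ) / 2 := by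
      rw [← Finset.sum_sub_distrib]
      exact hx₀term.trans (Finset.single_le_sum hterm hx₀)
    -- `g` moves by at most `2M`
    have hg : |s * g τ - s * g σ| ≤ 2 * M := by
      have h1 := hM τ
      have h2 := hM σ
      rcases hs with rfl | rfl
      · rw [one_mul, one_mul]
        calc |g τ - g σ| ≤ |g τ| + |g σ| := abs_sub _ _
          _ ≤ 2 * M := by linarith
      · rw [neg_one_mul, neg_one_mul, ← abs_neg]
        calc |-(-g τ - -g σ)| = |g τ - g σ| := by ring_nf
          _ ≤ |g τ| + |g σ| := abs_sub _ _
          _ ≤ 2 * M := by linarith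
    have := neg_abs_le (s * g τ - s * g σ)
    nlinarith

/-- **The difference of expectations of a bounded local observable under two ordered boundary
conditions is controlled by the one-point functions**: for `β ≥ 0`, `η₁ ≤ η₂`, `g` measurable with
`|g| ≤ M` depending only on the spins in `D`,
`|⟨g⟩^{η₂}_{Λ;β,h} - ⟨g⟩^{η₁}_{Λ;β,h}| ≤ M ∑_{x ∈ D} (⟨σ_x⟩^{η₂}_{Λ;β,h} - ⟨σ_x⟩^{η₁}_{Λ;β,h})`
(FKG monotonicity in the boundary condition applied to the monotonisations
`± g + 2M ∑_{x∈D}(1+σ_x)/2`; the mechanism of Friedli–Velenik 2017, Lemma 3.31 / Theorem 3.28: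
ordered states with equal magnetisations coincide). [cite: FriedliVelenik2017, Lemma 3.31 and Exercise 3.13] -/
theorem abs_isingExpect_fixed_sub_le_sum {β : ℝ} (hβ : 0 ≤ β) (Λ : Finset V) (h : ℝ)
    {η₁ η₂ : SpinConfig V} (hη : η₁ ≤ η₂) {g : SpinConfig V → ℝ} (hgm : Measurable g)
    {D : Finset V} (hgD : DependsOn g (↑D : Set V)) {M : ℝ} (hM : ∀ σ, |g σ| ≤ M) :
    |isingExpect G Λ β h (.fixed η₂) g - isingExpect G Λ β h (.fixed η₁) g| ≤
      M * ∑ x ∈ D, (isingExpect G Λ β h (.fixed η₂) (spinAt x) -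
        isingExpect G Λ β h (.fixed η₁) (spinAt x)) := by
  set N : SpinConfig V → ℝ := fun σ => ∑ x ∈ D, (1 + spinAt x σ) / 2 with hN
  have hNm : Measurable N := Finset.measurable_sum _ fun x _ =>
    (measurable_const.add (measurable_spinAt x)).div_const 2
  -- expectations of `N` and of the monotonisations, by linearity
  have hEN : ∀ η : SpinConfig V, isingExpect G Λ β h (.fixed η) N =
      ∑ x ∈ D, (1 + isingExpect G Λ β h (.fixed η) (spinAt x)) / 2 := by
    intro η
    rw [hN, isingExpect_finset_sum' G Λ h _ β D (fun x σ => (1 + spinAt x σ) / 2)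
      (fun x => (measurable_const.add (measurable_spinAt x)).div_const 2)]
    refine Finset.sum_congr rfl fun x _ => ?_
    have h1 : (fun σ => (1 + spinAt x σ) / 2) = fun σ => (1 / 2 : ℝ) * (1 : ℝ) + (1 / 2 : ℝ) * spinAt x σ := by
      funext σ; ring
    rw [h1, isingExpect_add' G Λ h _ β measurable_const ((measurable_spinAt x).const_mul _),
      isingExpect_const_mul' G Λ h _ β _ (measurable_spinAt x), isingExpect_const]
    ring
  have hEF : ∀ (η : SpinConfig V) (s : ℝ), isingExpect G Λ β h (.fixed η)
      (fun σ => s * g σ + 2 * M * N σ) =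
      s * isingExpect G Λ β h (.fixed η) g + 2 * M * isingExpect G Λ β h (.fixed η) N := by
    intro η s
    rw [isingExpect_add' G Λ h _ β (hgm.const_mul s) (hNm.const_mul _),
      isingExpect_const_mul' G Λ h _ β s hgm, isingExpect_const_mul' G Λ h _ β _ hNm]
  have hmono : ∀ s : ℝ, s = 1 ∨ s = -1 →
      s * isingExpect G Λ β h (.fixed η₁) g + 2 * M * isingExpect G Λ β h (.fixed η₁) N ≤
        s * isingExpect G Λ β h (.fixed η₂) g + 2 * M * isingExpect G Λ β h (.fixed η₂) N := by
    intro s hs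
    rw [← hEF, ← hEF]
    exact isingExpect_fixed_mono G hβ Λ h hη (monotone_smul_add_sum_of_dependsOn hgD hM hs)
      ((hgm.const_mul s).add (hNm.const_mul _))
  have hΔ : 2 * M * (isingExpect G Λ β h (.fixed η₂) N - isingExpect G Λ β h (.fixed η₁) N) =
      M * ∑ x ∈ D, (isingExpect G Λ β h (.fixed η₂) (spinAt x) -
        isingExpect G Λ β h (.fixed η₁) (spinAt x)) := by
    rw [hEN, hEN, ← Finset.sum_sub_distrib, Finset.mul_sum, Finset.mul_sum]
    refine Finset.sum_congr rfl fun x _ => ?_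
    ring
  have h1 := hmono 1 (Or.inl rfl)
  have h2 := hmono (-1) (Or.inr rfl)
  rw [abs_le]
  constructor <;> linarith

end Literature.Probability.LatticeModels

end
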